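import Mathlib
import Summits.KontsevichZagierPeriods.Zeta5Search.Elimination.PencilGauge
import HarnessLib

/-!
# ζ(5) search — class `elim`: THE BRIDGE TO THE DICTIONARY AND STAR (E-L18, part 3 of 3; cell `pub-zeta5`,
# fam-elim gen 22/23; continues `Elimination/PencilGauge.lean`): the D2 lane's conjectural nodes
# `WedgeDictionaryThreeTerm.DictPencil` / `DictStar` POINTWISE ON THE INTERIOR

HONEST FRAMING: systematic search; no irrationality claim unless certified.

OUR work (Summit side; `families/elim/FAMILY.md` §17).  Notation as in E-L17: `D(x) = (U, W, V)(x)`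
(`coeffU/W/V`), `C(x) = D(x) ∧ D(x + e₇)` with Plücker coordinates `casUW`, `casUV`, `casVW` (the
`ζ(3)`-eliminant of the contiguous pair `(x, x+e₇)` and its companion minor), `x⁺ = dsShift x`, `d = dOf`,
`ρ = rhoB = rhoCore · prodFNat`.
Inputs: the ρ-free pencil in every slot (`pencil_perm`, part 1), the gauge (`rhoB_dsShift`, `rhoB_lower`) and
the two polynomial identities per slot (`pencil_coeff_identities`) with the dictionary values `dict_values`
(part 2).
1. `dictPencil_at` — THE BRIDGE (gen-1's `DictPencil`, POINTWISE ON THE INTERIOR): for `a` with `RegionHyp` at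
   the three points `a`, `a + DS`, `a + DS − s_i` (`i ∈ [1,7]`), `c = b(a)`, and the interior side conditions
   `c_i ≥ 1`, `c_i + 1 ≤ c₀`, `c_j + c_k ≤ c₀` for the non-edge pairs `{j,k} ∌ i` (the edge pairs are
   automatic: `Converges a` IS `b₂, b₃ ≥ 0` plus the fifteen edge complements `≥ 0`,
   `WedgeDictionary.epairs_le_of_converges`):
   `DictThreeTerm (pencilBase c) (pencilApex c i) (fanCoeff (b(a+DS)) i) a (a+DS) (a+DS−s_i) j₀ j₁ j₂`,
   i.e. exactly the instance of `WedgeDictionaryThreeTerm.DictPencil` at `(a, i)`, consumable by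
   `at_of_threeTerm`.  Assembly: dictionary values `Q = ρ·(U∧W)`, `P̂ = ρ·(U∧V)`, `P = ρ·(V∧W)`
   (`wedgeDictionary_Q` + freeness, `dict_values`), items 1–2, and two polynomial identities per slot
   (`pencil_coeff_identities`, closed by evaluation).
2. `dictStar_at` — gen-1's `DictStar` POINTWISE ON THE INTERIOR, from two pencils: at `P = b(a)` the pencils
   of slots `i` and `k` based at `c = dsInv P` (`P = c⁺`), read at the apex, are the two legs `star_leg`
   `(d(P)+1)·fanCoeff(P,i)·v(a − s_i) = pencilBase(c)·F·ρ(P)·X(c) − (d(P)+1)·P_i(P₀+1−P_i)·v(a)` with a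
   common first term; their difference is STAR since `P_i(P₀+1−P_i) − P_k(P₀+1−P_k) = starKappa(P,i,k)`.
   Side conditions: all slots `P_m ≥ 1`, `P_i, P_k ≥ 2`, `P_i + 2, P_k + 2 ≤ P₀`, and `P_j + P_l ≤ P₀` for
   the non-edge pairs `{j,l} ≠ {i,k}`.
NOT REACHED here (the residual for the GLOBAL nodes `DictPencil` / `DictStar`): the strata `c_i = 0`,
`c_i ≥ c₀`, and a non-edge pair `{j,k} ∌ i` with `c_j + c_k = c₀ + 1` (odd `c₀`) — there `x = c − e_i` leaves
the region of CF-W3 (`rankThreeClosedForm`), on which E-L17 rests (for STAR also the low slots `P_m = 0`,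
`P_i = 1`).  What this is NOT: anything about sizes, denominators, valuations or irrationality; the class
verdict is unchanged (T1 NO / T2 NO / T4 YES).
-/

noncomputable section

open Finset

namespace Summit.KontsevichZagierPeriods.Zeta5Search.Elimination

open Summit.KontsevichZagierPeriods.Zeta5Search.DualSeries (InBox numPoly)
open Summit.KontsevichZagierPeriods.Zeta5Search.WedgeDictionary
open Summit.KontsevichZagierPeriods.Zeta5Search.SymmetricGauge
open Summit.KontsevichZagierPeriods.Zeta5Search.CasoratianValuation (shift)
open Literature.NumberTheory.Irrationality.BrownZudilin2022 (bOfA Converges QOf convergenceForms)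

/-! ### 6. The abstract assembly and the bridge -/

/-- The scalar skeleton of the bridge: the ρ-free pencil `Π·X_Q = B·X_c + A·X_P`, the two gauge identities, the two
polynomial identities and `β·d = p·A` give gen-1's relation `α·ρ_c X_c + β·ρ_P X_P + γ·ρ_Q X_Q = 0`. -/
theorem pencil_assemble {α β γ ρc ρP ρQ Xc XP XQ Pi B A F d χ p E : ℚ}
    (hT : Pi * XQ = B * Xc + A * XP) (h1 : ρP * F = -(d * ρc)) (h2 : ρQ * d * χ = -(p * E * ρP))
    (hs : γ * E = χ * Pi) (hss : α * F = -(p * B)) (h3 : β * d = p * A)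
    (hF : F ≠ 0) (hd : d ≠ 0) (hχ : χ ≠ 0) :
    α * (ρc * Xc) + β * (ρP * XP) + γ * (ρQ * XQ) = 0 := by
  have key : (d * F * χ) * (α * (ρc * Xc) + β * (ρP * XP) + γ * (ρQ * XQ)) = 0 := by
    linear_combination (d * χ * ρc * Xc) * hss + (d * χ * β * XP - p * χ * Pi * XQ) * h1 + (γ * F * XQ) * h2 +
      (-(p * F * ρP * XQ)) * hs + (p * χ * d * ρc) * hT + (-(d * χ * ρc * XP)) * h3
  rcases mul_eq_zero.1 key with h | h
  · exact absurd h (mul_ne_zero (mul_ne_zero hd hF) hχ)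
  · exact h

/-- **THE BRIDGE — gen-1's `DictPencil` pointwise on the interior.**  For `i ∈ [1,7]`, `RegionHyp` at the
three points `a`, `a + DS`, `a + DS − s_i`, `c = b(a)` with `c_i ≥ 1`, `c_i + 1 ≤ c₀` and `c_j + c_k ≤ c₀` for
the non-edge pairs `{j,k} ∌ i`:
`pencilBase(c)·v(a) + pencilApex(c,i)·v(a+DS) + fanCoeff(b(a+DS), i)·v(a+DS−s_i) = 0` for the three
dictionary coordinates `v = (Q, P̂, P)` (the instance of `WedgeDictionaryThreeTerm.DictPencil` at `(a, i)`). -/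
theorem dictPencil_at (a : Fin 8 → ℤ) (i j₀ j₁ j₂ : ℕ) (hi : i ∈ Icc 1 7) (H₀ : RegionHyp a j₀)
    (H₁ : RegionHyp (a + dsUp) j₁) (H₂ : RegionHyp (a + dsUp + slotDown i) j₂)
    (hi1 : 1 ≤ bOfA a i) (hi0 : bOfA a i + 1 ≤ bOfA a 0)
    (hNE : ∀ jk ∈ nonEpairs, jk.1 ≠ i → jk.2 ≠ i → bOfA a jk.1 + bOfA a jk.2 ≤ bOfA a 0) :
    DictThreeTerm (pencilBase (bOfA a)) (pencilApex (bOfA a) i) (fanCoeff (bOfA (a + dsUp)) i)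
      a (a + dsUp) (a + dsUp + slotDown i) j₀ j₁ j₂ := by
  obtain ⟨hi1', hi7⟩ := mem_Icc.1 hi
  obtain ⟨s, rfl⟩ : ∃ s, i = s + 1 := ⟨i - 1, by omega⟩
  have hs7 : s < 7 := by omega
  -- the dictionary values at the three points (before destructuring the hypotheses)
  obtain ⟨hQ0, hPh0, hP0⟩ := dict_values H₀
  obtain ⟨hQ1, hPh1, hP1⟩ := dict_values H₁
  obtain ⟨hQ2, hPh2, hP2⟩ := dict_values H₂
  obtain ⟨-, hconv, hreg, hd0, -⟩ := H₀
  obtain ⟨-, -, -, hd1, -⟩ := H₁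
  set c := bOfA a with hc
  -- facts at `c`
  have hE : ∀ jk ∈ Epairs, c jk.1 + c jk.2 ≤ c 0 := epairs_le_of_converges a hconv
  have hcs : ∀ k, 1 ≤ k → k ≤ 7 → 0 ≤ c k ∧ 2 * c k ≤ c 0 + 1 := fun k h1 h7 =>
    hreg k (mem_Icc.2 ⟨h1, h7⟩)
  have hcsl := hcs (s + 1) (by omega) (by omega)
  have hcI : InBox c := ⟨by omega, fun j hj => by
    have := hcs (j + 1) (by omega) (by have := mem_range.1 hj; omega); omega⟩
  -- the apex `P = c⁺` and the third point `x⁺`, `x = c − e_{s+1}`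
  have hPb : ∀ j, j ≤ 7 → bOfA (a + dsUp) j = dsShift c j := fun j hj => by
    rw [bOfA_add_dsUp a j hj, dsShift_apply]
  have hd : 1 ≤ dOf c := by rw [dOf_congr hPb, dOf_dsShift] at hd1; omega
  obtain ⟨x, hx⟩ : ∃ x : ℕ → ℤ, x = Function.update c (s + 1) (c (s + 1) - 1) := ⟨_, rfl⟩
  have x0 : x 0 = c 0 := by rw [hx, Function.update_of_ne (by omega)]
  have xs : x (s + 1) = c (s + 1) - 1 := by rw [hx, Function.update_self]
  have xk : ∀ k, k ≠ s + 1 → x k = c k := fun k hk => by rw [hx, Function.update_of_ne hk]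
  have hbx : bump x s = c := by
    rw [hx]; unfold bump
    rw [Function.update_self, Function.update_idem, sub_add_cancel, Function.update_eq_self]
  have hxd : dsShift x = Function.update (dsShift c) (s + 1) (dsShift c (s + 1) - 1) := by
    rw [hx, dsShift_update, sub_add_cancel, dsShift_succ, add_sub_cancel_right]
  have hQb : ∀ j, j ≤ 7 → bOfA (a + dsUp + slotDown (s + 1)) j = dsShift x j := fun j hj => by
    rw [bOfA_add_slotDown _ _ hi j hj, hPb j hj, hxd, Function.update_apply]
    split_ifs with h
    · rw [h]
    · rfl
  have hxI : InBox x := ⟨by rw [x0]; exact hcI.1, fun j hj => by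
    rcases eq_or_ne (j + 1) (s + 1) with h | h
    · rw [h, xs, x0]; omega
    · rw [xk _ h, x0]; exact hcI.2 j hj⟩
  have hdx : dOf x = dOf c + 1 := by
    have := dOf_bump x (i := s) (mem_range.2 hs7); rw [hbx] at this; omega
  have h7x : x (s + 1) + 2 ≤ x 0 := by rw [xs, x0]; omega
  have hpx : ∀ j k : ℕ, 1 ≤ j → j ≤ 7 → 1 ≤ k → k ≤ 7 → j ≠ k → x j + x k ≤ x 0 := by
    intro j k hj1 hj7 hk1 hk7 hjk
    rw [x0]
    wlog hlt : j < k generalizing j k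
    · have := this k j hk1 hk7 hj1 hj7 (Ne.symm hjk) (by omega); omega
    rcases eq_or_ne j (s + 1) with hj | hj
    · rw [hj, xs, xk k (by omega)]; have := hcs k hk1 hk7; omega
    · rcases eq_or_ne k (s + 1) with hk | hk
      · rw [hk, xs, xk j hj]; have := hcs j hj1 hj7; omega
      · rw [xk j hj, xk k hk]
        rcases pair_mem_epairs_or_nonEpairs j k hj1 hlt hk7 with hm | hm
        · exact hE (j, k) hm
        · exact hNE (j, k) hm hj hk
  -- (1) the ρ-free pencil in slot `s+1`
  have T := pencil_perm (Equiv.swap (⟨s, hs7⟩ : Fin 7) 6) x hxI (by simpa using h7x) (by omega) hpx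
  have hσ6 : ((Equiv.swap (⟨s, hs7⟩ : Fin 7) 6) 6).val = s := by rw [Equiv.swap_apply_right]
  simp only [hσ6] at T
  rw [hbx, bump_dsShift_slot, hbx] at T
  obtain ⟨TUW, TUV, TVW⟩ := T
  -- (2) the gauge
  have R1 := rhoB_dsShift c hcI hd
  have hEP : ∀ jk ∈ Epairs, dsShift c jk.1 + dsShift c jk.2 ≤ dsShift c 0 := fun jk hjk => by
    obtain ⟨h1, -, h2, -, -⟩ := epairs_bounds jk hjk
    rw [dsShift_zero, dsShift_of_pos c h1, dsShift_of_pos c h2]; have := hE jk hjk; omega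
  have R2 := rhoB_lower (dsShift c) hs7 (inBox_dsShift hcI) (by rw [dsShift_succ]; omega)
    (by rw [dOf_dsShift]; omega) hEP
  have hdd : ((dOf (dsShift c) : ℤ) : ℚ) + 1 = (dOf c : ℚ) := by rw [dOf_dsShift]; push_cast; ring
  rw [← hxd, hdd] at R2
  -- (3) the polynomial identities
  obtain ⟨PI1, PI2⟩ := pencil_coeff_identities c s hs7
  rw [← hx] at PI1 PI2
  have h3 : (pencilApex c (s + 1) : ℚ) * (dOf c : ℚ) =
      (dsShift c (s + 1) : ℚ) * (((dOf x : ℚ) - 1) * ((x 0 : ℚ) - x (s + 1) + 1)) := by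
    rw [hdx, x0, xs, dsShift_succ]; simp only [pencilApex]; push_cast; ring
  -- non-vanishing
  have hF : ((([1, 4, 5, 6, 7] : List ℕ).map fun j => ((c j : ℚ) + 1)).prod) ≠ 0 := by
    have p1 := (hcs 1 (by norm_num) (by norm_num)).1
    have p4 := (hcs 4 (by norm_num) (by norm_num)).1
    have p5 := (hcs 5 (by norm_num) (by norm_num)).1
    have p6 := (hcs 6 (by norm_num) (by norm_num)).1
    have p7 := (hcs 7 (by norm_num) (by norm_num)).1
    simp only [List.map_cons, List.map_nil, List.prod_cons, List.prod_nil, mul_one]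
    have q1 : (0 : ℚ) < c 1 + 1 := by have := (show (0 : ℚ) ≤ c 1 by exact_mod_cast p1); linarith
    have q4 : (0 : ℚ) < c 4 + 1 := by have := (show (0 : ℚ) ≤ c 4 by exact_mod_cast p4); linarith
    have q5 : (0 : ℚ) < c 5 + 1 := by have := (show (0 : ℚ) ≤ c 5 by exact_mod_cast p5); linarith
    have q6 : (0 : ℚ) < c 6 + 1 := by have := (show (0 : ℚ) ≤ c 6 by exact_mod_cast p6); linarith
    have q7 : (0 : ℚ) < c 7 + 1 := by have := (show (0 : ℚ) ≤ c 7 by exact_mod_cast p7); linarith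
    positivity
  have hdq : (dOf c : ℚ) ≠ 0 := by
    have : (1 : ℚ) ≤ dOf c := by exact_mod_cast hd
    exact ne_of_gt (by linarith)
  have hχ : (chiOf (dsShift c) (s + 1) : ℚ) ≠ 0 := by
    have : (1 : ℤ) ≤ chiOf (dsShift c) (s + 1) := by
      unfold chiOf; split_ifs
      · rw [dsShift_succ]; omega
      · exact le_refl _
    have : (1 : ℚ) ≤ chiOf (dsShift c) (s + 1) := by exact_mod_cast this
    exact ne_of_gt (by linarith)
  -- rewrite the nine dictionary values and the fan coefficient
  rw [rhoOf_eq_rhoB] at hQ0 hPh0 hP0 hQ1 hPh1 hP1 hQ2 hPh2 hP2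
  rw [rhoB_congr hPb, (cas_congr hPb).1] at hQ1
  rw [rhoB_congr hPb, (cas_congr hPb).2.1] at hPh1
  rw [rhoB_congr hPb, (cas_congr hPb).2.2] at hP1
  rw [rhoB_congr hQb, (cas_congr hQb).1] at hQ2
  rw [rhoB_congr hQb, (cas_congr hQb).2.1] at hPh2
  rw [rhoB_congr hQb, (cas_congr hQb).2.2] at hP2
  unfold DictThreeTerm
  rw [fanCoeff_congr hPb hi, hQ0, hPh0, hP0, hQ1, hPh1, hP1, hQ2, hPh2, hP2]
  exact ⟨pencil_assemble TUW R1 R2 PI1 PI2 h3 hF hdq hχ, pencil_assemble TUV R1 R2 PI1 PI2 h3 hF hdq hχ,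
    pencil_assemble TVW R1 R2 PI1 PI2 h3 hF hdq hχ⟩

/-! ### 7. STAR from two pencils -/

/-- The inverse diagonal step `P ↦ (P₀ − 2; P₁ − 1, P₂ − 1, …)`. -/
def dsInv (P : ℕ → ℤ) : ℕ → ℤ := fun j => if j = 0 then P 0 - 2 else P j - 1

/-- `dsShift` undoes `dsInv`. -/
@[simp] theorem dsShift_dsInv (P : ℕ → ℤ) : dsShift (dsInv P) = P := by
  funext j
  rcases j with _ | j
  · simp [dsInv]
  · simp [dsInv]

/-- Scalar skeleton of one STAR leg: the ρ-free pencil, the slot-step gauge, the two polynomial identities and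
`A = d·w` give `d·f·(ρ_Q X_Q) = αF·(ρ_P X_c) − d p w·(ρ_P X_P)`. -/
theorem leg_assemble {f ρQ XQ ρP XP Xc Pi B A F d χ p E α w : ℚ}
    (hT : Pi * XQ = B * Xc + A * XP) (hS : f * E = χ * Pi) (hG : ρQ * d * χ = -(p * E * ρP))
    (hU : α * F = -(p * B)) (hA : A = d * w) (hE : E ≠ 0) (hχ : χ ≠ 0) :
    d * (f * (ρQ * XQ)) = α * F * (ρP * Xc) - d * p * w * (ρP * XP) := by
  have key : (χ * E) * (d * (f * (ρQ * XQ)) - (α * F * (ρP * Xc) - d * p * w * (ρP * XP))) = 0 := by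
    linear_combination (χ * d * ρQ * XQ) * hS + (χ * Pi * XQ) * hG + (-(χ * p * E * ρP)) * hT +
      (-(χ * E * ρP * Xc)) * hU + (-(χ * p * E * ρP * XP)) * hA
  rcases mul_eq_zero.1 key with h | h
  · exact absurd h (mul_ne_zero hχ hE)
  · exact sub_eq_zero.1 h

/-- Scalar skeleton of STAR: two legs with the same slot-independent term `M` and `κ = p_i w_i − p_k w_k`. -/
theorem star_assemble {d fi fk vi vk v0 M pi pk wi wk κ : ℚ}
    (hi : d * (fi * vi) = M - d * pi * wi * v0) (hk : d * (fk * vk) = M - d * pk * wk * v0)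
    (hK : κ = pi * wi - pk * wk) (hd : d ≠ 0) : κ * v0 + (-fk) * vk + fi * vi = 0 := by
  have key : d * (κ * v0 + (-fk) * vk + fi * vi) = 0 := by linear_combination hi - hk + (d * v0) * hK
  rcases mul_eq_zero.1 key with h | h
  · exact absurd h hd
  · exact h

/-- **One STAR leg.**  At `P = b(a)` with `RegionHyp` at `a` and at `a − s_i` (`i ∈ [1,7]`), all slots
`P_m ≥ 1`, `P_i ≥ 2`, `P_i + 2 ≤ P₀`, and `P_j + P_l ≤ P₀` for the non-edge pairs `{j,l} ∌ i`; with
`c = dsInv P` (so `P = c⁺`) and `F = ∏_{j∈{1,4,5,6,7}}(c_j + 1)`: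
`(d(P)+1)·fanCoeff(P,i)·v(a − s_i) = pencilBase(c)·F·ρ(P)·X(c) − (d(P)+1)·P_i·(P₀+1−P_i)·v(a)`
for the three coordinates `(v, X) ∈ {(Q, U∧W), (P̂, U∧V), (P, V∧W)}` — the pencil of slot `i` at base `c`,
read at its apex.  The first term on the right does not depend on `i`. -/
theorem star_leg (a : Fin 8 → ℤ) (i j₀ j₂ : ℕ) (hi : i ∈ Icc 1 7) (H₀ : RegionHyp a j₀)
    (H₂ : RegionHyp (a + slotDown i) j₂) (hP1 : ∀ m ∈ Icc 1 7, 1 ≤ bOfA a m) (hi2 : 2 ≤ bOfA a i)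
    (hi0 : bOfA a i + 2 ≤ bOfA a 0)
    (hNE : ∀ jk ∈ nonEpairs, jk.1 ≠ i → jk.2 ≠ i → bOfA a jk.1 + bOfA a jk.2 ≤ bOfA a 0) :
    (((dOf (bOfA a) : ℚ) + 1) * ((fanCoeff (bOfA a) i : ℚ) * (QOf (a + slotDown i) : ℚ)) =
        (pencilBase (dsInv (bOfA a)) : ℚ) *
              ((([1, 4, 5, 6, 7] : List ℕ).map fun j => ((dsInv (bOfA a) j : ℚ) + 1)).prod) *
            (rhoB (bOfA a) * casUW (dsInv (bOfA a))) -
          ((dOf (bOfA a) : ℚ) + 1) * (bOfA a i : ℚ) * ((bOfA a 0 : ℚ) + 1 - bOfA a i) * (QOf a : ℚ)) ∧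
      (((dOf (bOfA a) : ℚ) + 1) * ((fanCoeff (bOfA a) i : ℚ) * dictPhat (a + slotDown i) j₂) =
          (pencilBase (dsInv (bOfA a)) : ℚ) *
                ((([1, 4, 5, 6, 7] : List ℕ).map fun j => ((dsInv (bOfA a) j : ℚ) + 1)).prod) *
              (rhoB (bOfA a) * casUV (dsInv (bOfA a))) -
            ((dOf (bOfA a) : ℚ) + 1) * (bOfA a i : ℚ) * ((bOfA a 0 : ℚ) + 1 - bOfA a i) * dictPhat a j₀) ∧
        (((dOf (bOfA a) : ℚ) + 1) * ((fanCoeff (bOfA a) i : ℚ) * dictP (a + slotDown i) j₂) =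
          (pencilBase (dsInv (bOfA a)) : ℚ) *
                ((([1, 4, 5, 6, 7] : List ℕ).map fun j => ((dsInv (bOfA a) j : ℚ) + 1)).prod) *
              (rhoB (bOfA a) * casVW (dsInv (bOfA a))) -
            ((dOf (bOfA a) : ℚ) + 1) * (bOfA a i : ℚ) * ((bOfA a 0 : ℚ) + 1 - bOfA a i) * dictP a j₀) := by
  obtain ⟨hi1', hi7⟩ := mem_Icc.1 hi
  obtain ⟨s, rfl⟩ : ∃ s, i = s + 1 := ⟨i - 1, by omega⟩
  have hs7 : s < 7 := by omega
  obtain ⟨hQ0, hPh0, hP0⟩ := dict_values H₀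
  obtain ⟨hQ2, hPh2, hP2⟩ := dict_values H₂
  obtain ⟨-, hconv, hreg, hd0, -⟩ := H₀
  obtain ⟨c, hcdef⟩ : ∃ c : ℕ → ℤ, c = dsInv (bOfA a) := ⟨_, rfl⟩
  rw [← hcdef]
  have hcP : dsShift c = bOfA a := by rw [hcdef, dsShift_dsInv]
  have c0 : c 0 = bOfA a 0 - 2 := by rw [hcdef]; simp [dsInv]
  have ck : ∀ k, k ≠ 0 → c k = bOfA a k - 1 := fun k hk => by rw [hcdef]; simp [dsInv, hk]
  have hE : ∀ jk ∈ Epairs, bOfA a jk.1 + bOfA a jk.2 ≤ bOfA a 0 := epairs_le_of_converges a hconv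
  have hPs : ∀ k, 1 ≤ k → k ≤ 7 → 1 ≤ bOfA a k ∧ 2 * bOfA a k ≤ bOfA a 0 + 1 := fun k h1 h7 =>
    ⟨hP1 k (mem_Icc.2 ⟨h1, h7⟩), (hreg k (mem_Icc.2 ⟨h1, h7⟩)).2⟩
  have hPsl := hPs (s + 1) (by omega) (by omega)
  have hPI : InBox (bOfA a) := ⟨by omega, fun j hj => by
    have := hPs (j + 1) (by omega) (by have := mem_range.1 hj; omega); omega⟩
  have csl : c (s + 1) = bOfA a (s + 1) - 1 := ck _ (by omega)
  have hcI : InBox c := ⟨by rw [c0]; omega, fun j hj => by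
    rw [ck (j + 1) (by omega), c0]; have := hPs (j + 1) (by omega) (by have := mem_range.1 hj; omega); omega⟩
  have hdc : dOf c = dOf (bOfA a) + 1 := by have := dOf_dsShift c; rw [hcP] at this; omega
  obtain ⟨x, hx⟩ : ∃ x : ℕ → ℤ, x = Function.update c (s + 1) (c (s + 1) - 1) := ⟨_, rfl⟩
  have x0 : x 0 = c 0 := by rw [hx, Function.update_of_ne (by omega)]
  have xs : x (s + 1) = c (s + 1) - 1 := by rw [hx, Function.update_self]
  have xk : ∀ k, k ≠ s + 1 → x k = c k := fun k hk => by rw [hx, Function.update_of_ne hk]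
  have hbx : bump x s = c := by
    funext k
    by_cases hk : k = s + 1
    · rw [hk, bump_self, xs]; ring
    · rw [bump_of_ne _ hk, xk _ hk]
  have hxd : dsShift x = Function.update (bOfA a) (s + 1) (bOfA a (s + 1) - 1) := by
    rw [hx, dsShift_update, hcP, sub_add_cancel, csl]
  have hQb : ∀ j, j ≤ 7 → bOfA (a + slotDown (s + 1)) j = dsShift x j := fun j hj => by
    rw [bOfA_add_slotDown _ _ hi j hj, hxd, Function.update_apply]
    split_ifs with h
    · rw [h]
    · rfl
  have hxI : InBox x := ⟨by rw [x0]; exact hcI.1, fun j hj => by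
    rcases eq_or_ne (j + 1) (s + 1) with h | h
    · rw [h, xs, x0, csl, c0]; omega
    · rw [xk _ h, x0]; exact hcI.2 j hj⟩
  have hdx : dOf x = dOf c + 1 := by
    have := dOf_bump x (i := s) (mem_range.2 hs7); rw [hbx] at this; omega
  have h7x : x (s + 1) + 2 ≤ x 0 := by rw [xs, x0, csl, c0]; omega
  have hpx : ∀ j k : ℕ, 1 ≤ j → j ≤ 7 → 1 ≤ k → k ≤ 7 → j ≠ k → x j + x k ≤ x 0 := by
    intro j k hj1 hj7 hk1 hk7 hjk
    rw [x0, c0]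
    wlog hlt : j < k generalizing j k
    · have := this k j hk1 hk7 hj1 hj7 (Ne.symm hjk) (by omega); omega
    rcases eq_or_ne j (s + 1) with hj | hj
    · rw [hj, xs, xk k (by omega), csl, ck k (by omega)]; have := hPs k hk1 hk7; omega
    · rcases eq_or_ne k (s + 1) with hk | hk
      · rw [hk, xs, xk j hj, csl, ck j (by omega)]; have := hPs j hj1 hj7; omega
      · rw [xk j hj, xk k hk, ck j (by omega), ck k (by omega)]
        rcases pair_mem_epairs_or_nonEpairs j k hj1 hlt hk7 with hm | hm
        · have : bOfA a j + bOfA a k ≤ bOfA a 0 := hE (j, k) hm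
          omega
        · have : bOfA a j + bOfA a k ≤ bOfA a 0 := hNE (j, k) hm hj hk
          omega
  -- (1) the ρ-free pencil in slot `s+1` at base `c`
  have T := pencil_perm (Equiv.swap (⟨s, hs7⟩ : Fin 7) 6) x hxI (by simpa using h7x) (by omega) hpx
  have hσ6 : ((Equiv.swap (⟨s, hs7⟩ : Fin 7) 6) 6).val = s := by rw [Equiv.swap_apply_right]
  simp only [hσ6] at T
  rw [hbx, bump_dsShift_slot, hbx, hcP] at T
  obtain ⟨TUW, TUV, TVW⟩ := T
  -- (2) the gauge of the slot step
  have R2 := rhoB_lower (bOfA a) hs7 hPI (by omega) hd0 hE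
  rw [← hxd] at R2
  -- (3) the polynomial identities
  obtain ⟨PI1, PI2⟩ := pencil_coeff_identities c s hs7
  rw [← hx, hcP] at PI1 PI2
  have hA : ((dOf x : ℚ) - 1) * ((x 0 : ℚ) - x (s + 1) + 1) =
      ((dOf (bOfA a) : ℚ) + 1) * ((bOfA a 0 : ℚ) + 1 - bOfA a (s + 1)) := by
    rw [hdx, hdc, x0, xs, csl, c0]; push_cast; ring
  -- non-vanishing
  have hEnz : edgeProd (bOfA a) (s + 1) ≠ 0 := by
    refine ne_of_gt ?_
    unfold edgeProd
    refine List.prod_pos fun q hq => ?_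
    rw [List.mem_map] at hq
    obtain ⟨jk, hjk, rfl⟩ := hq
    split_ifs
    · have h1 := hE jk hjk
      have : (bOfA a jk.1 : ℚ) + bOfA a jk.2 ≤ bOfA a 0 := by exact_mod_cast h1
      linarith
    · norm_num
  have hχ : (chiOf (bOfA a) (s + 1) : ℚ) ≠ 0 := by
    have : (1 : ℤ) ≤ chiOf (bOfA a) (s + 1) := by
      unfold chiOf; split_ifs
      · omega
      · exact le_refl _
    have : (1 : ℚ) ≤ chiOf (bOfA a) (s + 1) := by exact_mod_cast this
    exact ne_of_gt (by linarith)
  -- values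
  rw [rhoOf_eq_rhoB] at hQ0 hPh0 hP0 hQ2 hPh2 hP2
  rw [rhoB_congr hQb, (cas_congr hQb).1] at hQ2
  rw [rhoB_congr hQb, (cas_congr hQb).2.1] at hPh2
  rw [rhoB_congr hQb, (cas_congr hQb).2.2] at hP2
  rw [hQ0, hPh0, hP0, hQ2, hPh2, hP2]
  exact ⟨leg_assemble TUW PI1 R2 PI2 hA hEnz hχ, leg_assemble TUV PI1 R2 PI2 hA hEnz hχ,
    leg_assemble TVW PI1 R2 PI2 hA hEnz hχ⟩

/-- **STAR — gen-1's `DictStar` pointwise on the interior, from two pencils.**  For slots `i, k ∈ [1,7]`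
(for `i = k` the statement is trivial), `RegionHyp` at `a`, `a − s_k`, `a − s_i`, `P = b(a)` with all slots
`P_m ≥ 1`, `P_i, P_k ≥ 2`, `P_i + 2 ≤ P₀`, `P_k + 2 ≤ P₀`, and `P_j + P_l ≤ P₀` for every non-edge pair
`{j,l} ≠ {i,k}`: `starKappa(P,i,k)·v(a) − fanCoeff(P,k)·v(a − s_k) + fanCoeff(P,i)·v(a − s_i) = 0` for the
three dictionary coordinates (the instance of `WedgeDictionaryThreeTerm.DictStar` at `(a, i, k)`): the two
legs `star_leg` at `i` and at `k` share the base term, and `pencilApex(c,i) − pencilApex(c,k) = starKappa`. -/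
theorem dictStar_at (a : Fin 8 → ℤ) (i k j₀ j₁ j₂ : ℕ) (hi : i ∈ Icc 1 7) (hk : k ∈ Icc 1 7)
    (H₀ : RegionHyp a j₀) (H₁ : RegionHyp (a + slotDown k) j₁) (H₂ : RegionHyp (a + slotDown i) j₂)
    (hP1 : ∀ m ∈ Icc 1 7, 1 ≤ bOfA a m) (hi2 : 2 ≤ bOfA a i) (hk2 : 2 ≤ bOfA a k)
    (hi0 : bOfA a i + 2 ≤ bOfA a 0) (hk0 : bOfA a k + 2 ≤ bOfA a 0)
    (hNE : ∀ jk ∈ nonEpairs, ¬(jk.1 = i ∧ jk.2 = k) → ¬(jk.1 = k ∧ jk.2 = i) →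
      bOfA a jk.1 + bOfA a jk.2 ≤ bOfA a 0) :
    DictThreeTerm (starKappa (bOfA a) i k) (-fanCoeff (bOfA a) k) (fanCoeff (bOfA a) i)
      a (a + slotDown k) (a + slotDown i) j₀ j₁ j₂ := by
  obtain ⟨Li1, Li2, Li3⟩ := star_leg a i j₀ j₂ hi H₀ H₂ hP1 hi2 hi0
    (fun jk hjk h1 h2 => hNE jk hjk (fun h => h1 h.1) (fun h => h2 h.2))
  obtain ⟨Lk1, Lk2, Lk3⟩ := star_leg a k j₀ j₁ hk H₀ H₁ hP1 hk2 hk0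
    (fun jk hjk h1 h2 => hNE jk hjk (fun h => h2 h.2) (fun h => h1 h.1))
  obtain ⟨-, -, -, hd0, -⟩ := H₀
  have hd : ((dOf (bOfA a) : ℚ) + 1) ≠ 0 := by
    have : (0 : ℚ) ≤ dOf (bOfA a) := by exact_mod_cast hd0
    exact ne_of_gt (by linarith)
  have K : (starKappa (bOfA a) i k : ℚ) = (bOfA a i : ℚ) * ((bOfA a 0 : ℚ) + 1 - bOfA a i) -
      (bOfA a k : ℚ) * ((bOfA a 0 : ℚ) + 1 - bOfA a k) := by
    simp only [starKappa]; push_cast; ring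
  unfold DictThreeTerm
  exact ⟨star_assemble Li1 Lk1 K hd, star_assemble Li2 Lk2 K hd, star_assemble Li3 Lk3 K hd⟩

end Summit.KontsevichZagierPeriods.Zeta5Search.Elimination

end
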